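import Summits.SmoothPoincare4.SmoothPoincare4.Theorems.CongruenceShadowsAgkCor6SufficiencyStubCoresMorse
import Summits.SmoothPoincare4.SmoothPoincare4.Theorems.CongruenceShadowsAgkCor6SufficiencyStubSectorCoresHelpers
import Summits.SmoothPoincare4.SmoothPoincare4.Theorems.CongruenceShadowsAgkCor6SufficiencyStubSectorCoresLevelFunction
import Literature.Topology.FourManifolds.RegularDomainMaps

/-!
# The level function of a normalised spine presentation — helpers for stub `stub_cores` of line
`lp-by-sphere-system-surgery` (crux `AgkCor6Sufficiency`, item stmt-SmoothPoincare4-10894, routes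
CongruenceShadows / GroupTrisection; lead reshape r5, D)

For a normalised ambient Morse presentation `hP : SpinePresentation S u v ρ U O T₀ G k`
(`…SpineDefs.lean`) and a scale `a > 0`, the **level function** is the smooth function
`f : X → ℝ` with `f = coreProfile ((1 - G m) · 2/a)` on each sector `S m` (`exists_levelFun`:
well defined because two sectors only meet at non-interior points, where both presentations
equal `1` and the profile vanishes; smooth because it is `coreProfile ∘ affine ∘ G m` on the open
sector and vanishes identically near the spine).  Its level sets on `S m` are those of `G m`
(`{f ≤ 1/2} = {G m ≥ 1 - a/4}`, `{f ≥ 1/2} = {G m ≤ 1 - a/4}`), and `1/2` is a regular level as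
soon as the interior critical values of the `G m` lie below `1 - a/4`
(`isRegularLevel_levelFun`, chain rule with `coreProfile' (1/2) ≠ 0`).  Both this condition and
"`{G m ≥ 1 - a/4} ∩ S m` lies in a given neighbourhood of the non-interior points" hold for all
small `a` (`eventually_criticalValues_lt`, `eventually_superlevel_subset`: finitely many interior
critical points, all with value `< 1`; compactness).  Finally
`nonempty_diffeomorph_sublevel_of_transport`: two regular sublevel sets `{f ≤ 1/2} ⊆ X`,
`{f' ≤ 1/2} ⊆ X'` corresponding under mutually inverse maps, smooth on open neighbourhoods and
preserving the sublevel sets, are diffeomorphic (smoothness into a regular domain is tested in the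
ambient manifold, `HalfSliceAtlas.contMDiff_codRestrict`).  The results are bundled in the
registered helper stub `stub_coresLevelToolkit : CoresLevelToolkit`.

## References

* A. Abrams, D. Gay, R. Kirby, *Group trisections and smooth 4-manifolds*, Geom. Topol. 22
  (2018), proof of Thm. 5. [AbramsGayKirby2018]
* J. Milnor, *Morse theory*, Ann. of Math. Studies 51 (1963), Thm. 3.1. [Milnor1963]
-/

noncomputable section

-- the prescribed namespace `Summit.<P>.<Sub>.…` duplicates `SmoothPoincare4` (P = Sub)
set_option linter.dupNamespace false

namespace Summit.SmoothPoincare4.SmoothPoincare4.Cruxes.AgkCor6Sufficiency.LpBySphereSystemSurgery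

open Set Function Filter
open scoped _root_.Manifold _root_.ContDiff _root_.Topology
open Literature.Topology.FourManifolds

/-! ## 1. The scaled profile `coreProfile ((1 - g) · 2/a)` -/

section Profile

variable {a : ℝ}

/-- `coreProfile ((1 - g) · 2/a) ≤ 1/2 ↔ 1 - a/4 ≤ g` (`a > 0`). [folklore] -/
theorem coreProfile_scale_le_half_iff (ha : 0 < a) (g : ℝ) :
    coreProfile ((1 - g) * (2 / a)) ≤ 1 / 2 ↔ 1 - a / 4 ≤ g := by
  rw [coreProfile_le_half_iff, show (1 - g) * (2 / a) = (1 - g) * 2 / a by ring, div_le_iff₀ ha]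
  constructor <;> intro h <;> linarith

/-- `1/2 ≤ coreProfile ((1 - g) · 2/a) ↔ g ≤ 1 - a/4` (`a > 0`). [folklore] -/
theorem half_le_coreProfile_scale_iff (ha : 0 < a) (g : ℝ) :
    1 / 2 ≤ coreProfile ((1 - g) * (2 / a)) ↔ g ≤ 1 - a / 4 := by
  rw [half_le_coreProfile_iff, show (1 - g) * (2 / a) = (1 - g) * 2 / a by ring, le_div_iff₀ ha]
  constructor <;> intro h <;> linarith

/-- `coreProfile ((1 - g) · 2/a) = 1/2 ↔ g = 1 - a/4` (`a > 0`). [folklore] -/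
theorem coreProfile_scale_eq_half_iff (ha : 0 < a) (g : ℝ) :
    coreProfile ((1 - g) * (2 / a)) = 1 / 2 ↔ g = 1 - a / 4 := by
  rw [le_antisymm_iff, le_antisymm_iff, coreProfile_scale_le_half_iff ha,
    half_le_coreProfile_scale_iff ha]
  exact and_comm

/-- `coreProfile ((1 - g) · 2/a) = 0` for `g > 1 - a/8` (`a > 0`). [folklore] -/
theorem coreProfile_scale_eq_zero (ha : 0 < a) {g : ℝ} (hg : 1 - a / 8 < g) :
    coreProfile ((1 - g) * (2 / a)) = 0 := by
  apply coreProfile_of_le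
  rw [show (1 - g) * (2 / a) = (1 - g) * 2 / a by ring, div_le_iff₀ ha]
  linarith

/-- **The scaled profile is regular at its level `1/2`**: `s ↦ coreProfile ((1 - s) · 2/a)` has
nonzero derivative at `s = 1 - a/4`. [folklore] -/
theorem hasDerivAt_coreProfile_scale (ha : 0 < a) :
    ∃ d : ℝ, d ≠ 0 ∧ HasDerivAt (fun s : ℝ => coreProfile ((1 - s) * (2 / a))) d (1 - a / 4) := by
  obtain ⟨d, hd, hder⟩ := hasDerivAt_coreProfile_half
  have hinner : HasDerivAt (fun s : ℝ => (1 - s) * (2 / a)) (-(2 / a)) (1 - a / 4) := by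
    have := ((hasDerivAt_id (1 - a / 4)).const_sub 1).mul_const (2 / a)
    simpa using this
  refine ⟨d * -(2 / a), mul_ne_zero hd (neg_ne_zero.2 (div_ne_zero two_ne_zero ha.ne')), ?_⟩
  exact hder.comp_of_eq (1 - a / 4) hinner (by field_simp; ring)

end Profile

/-! ## 2. The level function of a presentation -/

section Level

variable {X : Type} [TopologicalSpace X] [ChartedSpace (EuclideanSpace ℝ (Fin 4)) X]
  {S : Fin 3 → Set X} {u v : X → ℝ} {ρ : X → X} {U O T₀ : Set X} {G : Fin 3 → X → ℝ} {k : ℕ}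

/-- Every point lies in some sector. -/
theorem SpinePresentation.exists_mem (hP : SpinePresentation S u v ρ U O T₀ G k) (x : X) :
    ∃ m, x ∈ S m := by
  have hx : x ∈ ⋃ m, S m := by rw [hP.tri.cover]; exact mem_univ x
  exact mem_iUnion.1 hx

/-- **The level function of a normalised presentation at scale `a > 0`**: a smooth `f : X → ℝ`
with `f = coreProfile ((1 - G m) · 2/a)` on every sector `S m`.  (On `S m ∩ S m'`, `m ≠ m'`,
both presentations equal `1`, so `f` is well defined; it is `coreProfile ∘ affine ∘ G m` on the
open sector and `≡ 0` off the closed set `⋃ m {G m ≤ 1 - a/8} ∩ S m`, which misses the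
non-interior points.) [cite: AbramsGayKirby2018, proof of Thm. 5] -/
theorem exists_levelFun [T2Space X] (hP : SpinePresentation S u v ρ U O T₀ G k) {a : ℝ}
    (ha : 0 < a) :
    ∃ f : X → ℝ, ContMDiff (𝓡 4) 𝓘(ℝ, ℝ) ∞ f ∧
      ∀ m, ∀ x ∈ S m, f x = coreProfile ((1 - G m x) * (2 / a)) := by
  classical
  choose σ hσ using hP.exists_mem
  set f : X → ℝ := fun x => coreProfile ((1 - G (σ x) x) * (2 / a)) with hf
  have hfS : ∀ m, ∀ x ∈ S m, f x = coreProfile ((1 - G m x) * (2 / a)) := by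
    intro m x hx
    by_cases hm : σ x = m
    · subst hm; rfl
    · have h1 : G m x = 1 :=
        hP.G_eq_one m x hx (hP.not_mem_interior_of_mem (Ne.symm hm) (hσ x))
      have h2 : G (σ x) x = 1 :=
        hP.G_eq_one (σ x) x (hσ x) (hP.not_mem_interior_of_mem hm hx)
      show coreProfile ((1 - G (σ x) x) * (2 / a)) = coreProfile ((1 - G m x) * (2 / a))
      rw [h1, h2]
  refine ⟨f, fun x => ?_, hfS⟩
  by_cases hxi : ∃ m, x ∈ interior (S m)
  · obtain ⟨m, hxm⟩ := hxi
    have hg : ContMDiff (𝓡 4) 𝓘(ℝ, ℝ) ∞ (fun y => coreProfile ((1 - G m y) * (2 / a))) :=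
      (contDiff_coreProfile.comp ((contDiff_const.sub contDiff_id).mul contDiff_const)).comp_contMDiff
        (hP.contMDiff_G m)
    refine hg.contMDiffAt.congr_of_eventuallyEq ?_
    filter_upwards [isOpen_interior.mem_nhds hxm] with y hy
    exact hfS m y (interior_subset hy)
  · push Not at hxi
    set Z : Set X := ⋃ m, {y | y ∈ S m ∧ G m y ≤ 1 - a / 8} with hZ
    have hZc : IsClosed Z := isClosed_iUnion_of_finite fun m =>
      (hP.tri.isCompact m).isClosed.inter (isClosed_le (hP.contMDiff_G m).continuous continuous_const)
    have hxZ : x ∉ Z := by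
      intro hxZ
      obtain ⟨m, hxm, hle⟩ := mem_iUnion.1 hxZ
      have := hP.G_eq_one m x hxm (hxi m)
      linarith
    refine (contMDiffAt_const (c := (0 : ℝ))).congr_of_eventuallyEq ?_
    filter_upwards [hZc.isOpen_compl.mem_nhds hxZ] with y hy
    have hlt : 1 - a / 8 < G (σ y) y := not_le.1 fun hle => hy (mem_iUnion.2 ⟨σ y, hσ y, hle⟩)
    exact coreProfile_scale_eq_zero ha hlt

/-- **`1/2` is a regular level of the level function** once the interior critical values of the
`G m` lie below `1 - a/4`: a point of the level lies in an open sector, where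
`f = coreProfile ((1 - G m) · 2/a)` with `G m = 1 - a/4` regular, and the scaled profile has
nonzero derivative there (chain rule). [cite: Milnor1963, Thm. 3.1] -/
theorem isRegularLevel_levelFun (hP : SpinePresentation S u v ρ U O T₀ G k) {a : ℝ} (ha : 0 < a)
    (hCV : ∀ m, ∀ x ∈ interior (S m), IsMCriticalPt (𝓡 4) (G m) x → G m x < 1 - a / 4)
    {f : X → ℝ} (hf : ContMDiff (𝓡 4) 𝓘(ℝ, ℝ) ∞ f)
    (hfS : ∀ m, ∀ x ∈ S m, f x = coreProfile ((1 - G m x) * (2 / a))) :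
    IsRegularLevel (𝓡 4) f (1 / 2) := by
  refine isRegularLevel_of_not_isMCriticalPt hf fun x hx hc => ?_
  obtain ⟨m, hxm⟩ := hP.exists_mem x
  have hGx : G m x = 1 - a / 4 := (coreProfile_scale_eq_half_iff ha (G m x)).1 (hfS m x hxm ▸ hx)
  have hxi : x ∈ interior (S m) := hP.mem_interior_of_lt hxm (by rw [hGx]; linarith)
  set g : ℝ → ℝ := fun s => coreProfile ((1 - s) * (2 / a)) with hg
  have heq : f =ᶠ[𝓝 x] (g ∘ G m) := by
    filter_upwards [isOpen_interior.mem_nhds hxi] with y hy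
    exact hfS m y (interior_subset hy)
  have hc' : IsMCriticalPt (𝓡 4) (g ∘ G m) x := by
    unfold IsMCriticalPt at hc ⊢
    rwa [← heq.mfderiv_eq]
  obtain ⟨d, hd, hder⟩ := hasDerivAt_coreProfile_scale ha
  rw [← hGx] at hder
  exact (hCV m x hxi (isMCriticalPt_of_comp ((hP.contMDiff_G m).mdifferentiableAt (by simp)) hder
    hd hc')).ne hGx

omit [TopologicalSpace X] [ChartedSpace (EuclideanSpace ℝ (Fin 4)) X] in
/-- On `S m`: `f ≤ 1/2 ↔ 1 - a/4 ≤ G m`. -/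
theorem levelFun_le_half_iff {a : ℝ} (ha : 0 < a) {f : X → ℝ}
    (hfS : ∀ m, ∀ x ∈ S m, f x = coreProfile ((1 - G m x) * (2 / a))) {m : Fin 3} {x : X}
    (hx : x ∈ S m) : f x ≤ 1 / 2 ↔ 1 - a / 4 ≤ G m x := by
  rw [hfS m x hx]; exact coreProfile_scale_le_half_iff ha _

omit [TopologicalSpace X] [ChartedSpace (EuclideanSpace ℝ (Fin 4)) X] in
/-- On `S m`: `1/2 ≤ f ↔ G m ≤ 1 - a/4`. -/
theorem half_le_levelFun_iff {a : ℝ} (ha : 0 < a) {f : X → ℝ}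
    (hfS : ∀ m, ∀ x ∈ S m, f x = coreProfile ((1 - G m x) * (2 / a))) {m : Fin 3} {x : X}
    (hx : x ∈ S m) : 1 / 2 ≤ f x ↔ G m x ≤ 1 - a / 4 := by
  rw [hfS m x hx]; exact half_le_coreProfile_scale_iff ha _

/-! ## 3. Small scales -/

/-- `a ↦ 1 - a/4` tends to `1` at `0`. [folklore] -/
theorem tendsto_level : Tendsto (fun a : ℝ => 1 - a / 4) (𝓝 0) (𝓝 1) := by
  have h : Continuous fun a : ℝ => 1 - a / 4 := by fun_prop
  simpa using h.tendsto 0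

/-- **For small scales the level `1 - a/4` lies above all interior critical values** (finitely
many interior critical points, `finite_interior_inter_criticalSet`, each with value `< 1`). -/
theorem eventually_criticalValues_lt [IsManifold (𝓡 4) ∞ X] (hP : SpinePresentation S u v ρ U O T₀ G k) :
    ∀ᶠ a in 𝓝 (0 : ℝ), ∀ m, ∀ x ∈ interior (S m), IsMCriticalPt (𝓡 4) (G m) x → G m x < 1 - a / 4 := by
  have key : ∀ m, ∀ᶠ a in 𝓝 (0 : ℝ),
      ∀ t ∈ G m '' (interior (S m) ∩ criticalSet (𝓡 4) (G m)), t < 1 - a / 4 := by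
    intro m
    rw [((hP.finite_interior_inter_criticalSet m).image _).eventually_all]
    rintro t ⟨x, ⟨hxi, -⟩, rfl⟩
    exact tendsto_level.eventually_const_lt (hP.G_lt_one m x hxi)
  filter_upwards [Filter.eventually_all.2 key] with a ha m x hxi hxc
  exact ha m (G m x) ⟨x, ⟨hxi, hxc⟩, rfl⟩

/-- **For small scales the region `{G m ≥ 1 - a/4} ∩ S m` lies in any open neighbourhood `W` of
the non-interior points of the sectors**: on the compact `S m ∖ W` (interior points) `G m < 1`
attains a maximum `< 1`. -/
theorem eventually_superlevel_subset (hP : SpinePresentation S u v ρ U O T₀ G k)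
    {W : Set X} (hW : IsOpen W) (hWS : ∀ m, ∀ x ∈ S m, x ∉ interior (S m) → x ∈ W) :
    ∀ᶠ a in 𝓝 (0 : ℝ), ∀ m, ∀ x ∈ S m, 1 - a / 4 ≤ G m x → x ∈ W := by
  refine Filter.eventually_all.2 fun m => ?_
  set K : Set X := S m ∩ Wᶜ with hK
  have hKc : IsCompact K := (hP.tri.isCompact m).inter_right hW.isClosed_compl
  rcases K.eq_empty_or_nonempty with hKe | hKne
  · refine Filter.Eventually.of_forall fun a x hx _ => ?_
    by_contra hxW
    have : x ∈ K := ⟨hx, hxW⟩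
    rw [hKe] at this
    exact this
  · obtain ⟨x₀, hx₀, hmax⟩ := hKc.exists_isMaxOn hKne (hP.contMDiff_G m).continuous.continuousOn
    have hlt : G m x₀ < 1 :=
      hP.G_lt_one m x₀ (by by_contra h; exact hx₀.2 (hWS m x₀ hx₀.1 h))
    filter_upwards [tendsto_level.eventually_const_lt hlt] with a ha x hx hle
    by_contra hxW
    have hxle : G m x ≤ G m x₀ := hmax (show x ∈ K from ⟨hx, hxW⟩)
    linarith

end Level

/-! ## 4. Transport of regular sublevel sets -/

section Transport

variable {X : Type} [TopologicalSpace X] [ChartedSpace (EuclideanSpace ℝ (Fin 4)) X]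
  [IsManifold (𝓡 4) ∞ X]
  {X' : Type} [TopologicalSpace X'] [ChartedSpace (EuclideanSpace ℝ (Fin 4)) X']
  [IsManifold (𝓡 4) ∞ X']

/-- **Regular sublevel sets corresponding under a transport are diffeomorphic.**  If
`{f ≤ 1/2} ⊆ Ug`, `{f' ≤ 1/2} ⊆ Ug'` for opens on which `Γ : X → X'`, `Γ' : X' → X` are smooth,
`Γ`, `Γ'` map the sublevel sets into each other and are mutually inverse on them, then
`p ↦ Γ p` is a diffeomorphism `{f ≤ 1/2} ≅ {f' ≤ 1/2}` of the regular sublevel sets (smoothness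
into a regular domain is tested in the ambient manifold, Lee (2013), Cor. 5.30,
`HalfSliceAtlas.contMDiff_codRestrict`). [cite: Milnor1963, Thm. 3.1] -/
theorem nonempty_diffeomorph_sublevel_of_transport {f : X → ℝ} {f' : X' → ℝ}
    (hf : IsRegularLevel (𝓡 4) f (1 / 2)) (hf' : IsRegularLevel (𝓡 4) f' (1 / 2))
    {Ug : Set X} {Ug' : Set X'} {Γ : X → X'} {Γ' : X' → X}
    (hΓs : ContMDiffOn (𝓡 4) (𝓡 4) ∞ Γ Ug) (hΓ's : ContMDiffOn (𝓡 4) (𝓡 4) ∞ Γ' Ug')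
    (hsub : ∀ x, f x ≤ 1 / 2 → x ∈ Ug) (hsub' : ∀ y, f' y ≤ 1 / 2 → y ∈ Ug')
    (hlev : ∀ x, f x ≤ 1 / 2 → f' (Γ x) ≤ 1 / 2) (hlev' : ∀ y, f' y ≤ 1 / 2 → f (Γ' y) ≤ 1 / 2)
    (hinv : ∀ x, f x ≤ 1 / 2 → Γ' (Γ x) = x) (hinv' : ∀ y, f' y ≤ 1 / 2 → Γ (Γ' y) = y) :
    Nonempty (RegularSublevel hf ≃ₘ⟮𝓡∂ 4, 𝓡∂ 4⟯ RegularSublevel hf') := by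
  have h1 : ContMDiff (𝓡∂ 4) (𝓡 4) ∞ (fun p : RegularSublevel hf => Γ (RegularSublevel.incl hf p)) :=
    hΓs.comp_contMDiff (RegularSublevel.contMDiff_incl hf) fun p => hsub _ p.2
  have h2 : ContMDiff (𝓡∂ 4) (𝓡 4) ∞ (fun q : RegularSublevel hf' => Γ' (RegularSublevel.incl hf' q)) :=
    hΓ's.comp_contMDiff (RegularSublevel.contMDiff_incl hf') fun q => hsub' _ q.2
  have hm1 : ∀ p : RegularSublevel hf, Γ (RegularSublevel.incl hf p) ∈ f' ⁻¹' Iic (1 / 2) :=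
    fun p => hlev _ p.2
  have hm2 : ∀ q : RegularSublevel hf', Γ' (RegularSublevel.incl hf' q) ∈ f ⁻¹' Iic (1 / 2) :=
    fun q => hlev' _ q.2
  exact
   ⟨{ toFun := Set.codRestrict (fun p : RegularSublevel hf => Γ (RegularSublevel.incl hf p)) _ hm1
      invFun := Set.codRestrict (fun q : RegularSublevel hf' => Γ' (RegularSublevel.incl hf' q)) _ hm2
      left_inv := fun p => Subtype.ext (hinv _ p.2)
      right_inv := fun q => Subtype.ext (hinv' _ q.2)
      contMDiff_toFun := (RegularSublevel.halfSliceAtlas hf').contMDiff_codRestrict hm1 h1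
      contMDiff_invFun := (RegularSublevel.halfSliceAtlas hf).contMDiff_codRestrict hm2 h2 }⟩

end Transport

/-! ## 5. The registered helper stub -/

/-- **The level-function toolkit of the cores** (registered helper stub of `stub_cores`): for a
normalised presentation, (1) the level function at scale `a > 0` exists (smooth,
`= coreProfile ((1 - G m) · 2/a)` on `S m`); (2) `1/2` is a regular level of any such function once
the interior critical values lie below `1 - a/4`; (3)–(4) for all small `a` the interior critical
values lie below `1 - a/4` and `{G m ≥ 1 - a/4} ∩ S m` lies in any open neighbourhood of the
non-interior points; (5) regular sublevel sets corresponding under a transport are diffeomorphic.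
(A conjunction of statements PROVED in this file — `stub_coresLevelToolkit` —, not a named fact.) -/
def CoresLevelToolkit : Prop :=
  (∀ (X : Type) [TopologicalSpace X] [T2Space X] [ChartedSpace (EuclideanSpace ℝ (Fin 4)) X]
    (S : Fin 3 → Set X) (u v : X → ℝ) (ρ : X → X) (U O T₀ : Set X) (G : Fin 3 → X → ℝ) (k : ℕ)
    (_ : SpinePresentation S u v ρ U O T₀ G k) (a : ℝ), 0 < a →
    ∃ f : X → ℝ, ContMDiff (𝓡 4) 𝓘(ℝ, ℝ) ∞ f ∧
      ∀ m, ∀ x ∈ S m, f x = coreProfile ((1 - G m x) * (2 / a))) ∧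
  (∀ (X : Type) [TopologicalSpace X] [ChartedSpace (EuclideanSpace ℝ (Fin 4)) X]
    (S : Fin 3 → Set X) (u v : X → ℝ) (ρ : X → X) (U O T₀ : Set X) (G : Fin 3 → X → ℝ) (k : ℕ)
    (_ : SpinePresentation S u v ρ U O T₀ G k) (a : ℝ), 0 < a →
    (∀ m, ∀ x ∈ interior (S m), IsMCriticalPt (𝓡 4) (G m) x → G m x < 1 - a / 4) →
    ∀ f : X → ℝ, ContMDiff (𝓡 4) 𝓘(ℝ, ℝ) ∞ f →
    (∀ m, ∀ x ∈ S m, f x = coreProfile ((1 - G m x) * (2 / a))) → IsRegularLevel (𝓡 4) f (1 / 2)) ∧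
  (∀ (X : Type) [TopologicalSpace X] [ChartedSpace (EuclideanSpace ℝ (Fin 4)) X] [IsManifold (𝓡 4) ∞ X]
    (S : Fin 3 → Set X) (u v : X → ℝ) (ρ : X → X) (U O T₀ : Set X) (G : Fin 3 → X → ℝ) (k : ℕ)
    (_ : SpinePresentation S u v ρ U O T₀ G k),
    ∀ᶠ a in 𝓝 (0 : ℝ), ∀ m, ∀ x ∈ interior (S m), IsMCriticalPt (𝓡 4) (G m) x → G m x < 1 - a / 4) ∧
  (∀ (X : Type) [TopologicalSpace X] [ChartedSpace (EuclideanSpace ℝ (Fin 4)) X]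
    (S : Fin 3 → Set X) (u v : X → ℝ) (ρ : X → X) (U O T₀ : Set X) (G : Fin 3 → X → ℝ) (k : ℕ)
    (_ : SpinePresentation S u v ρ U O T₀ G k) (W : Set X), IsOpen W →
    (∀ m, ∀ x ∈ S m, x ∉ interior (S m) → x ∈ W) →
    ∀ᶠ a in 𝓝 (0 : ℝ), ∀ m, ∀ x ∈ S m, 1 - a / 4 ≤ G m x → x ∈ W) ∧
  (∀ (X : Type) [TopologicalSpace X] [ChartedSpace (EuclideanSpace ℝ (Fin 4)) X] [IsManifold (𝓡 4) ∞ X]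
    (X' : Type) [TopologicalSpace X'] [ChartedSpace (EuclideanSpace ℝ (Fin 4)) X']
    [IsManifold (𝓡 4) ∞ X'] (f : X → ℝ) (f' : X' → ℝ)
    (hf : IsRegularLevel (𝓡 4) f (1 / 2)) (hf' : IsRegularLevel (𝓡 4) f' (1 / 2))
    (Ug : Set X) (Ug' : Set X') (Γ : X → X') (Γ' : X' → X),
    ContMDiffOn (𝓡 4) (𝓡 4) ∞ Γ Ug → ContMDiffOn (𝓡 4) (𝓡 4) ∞ Γ' Ug' →
    (∀ x, f x ≤ 1 / 2 → x ∈ Ug) → (∀ y, f' y ≤ 1 / 2 → y ∈ Ug') →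
    (∀ x, f x ≤ 1 / 2 → f' (Γ x) ≤ 1 / 2) → (∀ y, f' y ≤ 1 / 2 → f (Γ' y) ≤ 1 / 2) →
    (∀ x, f x ≤ 1 / 2 → Γ' (Γ x) = x) → (∀ y, f' y ≤ 1 / 2 → Γ (Γ' y) = y) →
    Nonempty (RegularSublevel hf ≃ₘ⟮𝓡∂ 4, 𝓡∂ 4⟯ RegularSublevel hf'))

/-- **Registered helper stub `stub_coresLevelToolkit`** of line `lp-by-sphere-system-surgery`
(level-function toolkit for `stub_cores`). [cite: AbramsGayKirby2018, proof of Thm. 5] -/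
theorem stub_coresLevelToolkit : CoresLevelToolkit :=
  ⟨fun _ _ _ _ _ _ _ _ _ _ _ _ _ hP _ ha => exists_levelFun hP ha,
    fun _ _ _ _ _ _ _ _ _ _ _ _ hP _ ha hCV _ hf hfS => isRegularLevel_levelFun hP ha hCV hf hfS,
    fun _ _ _ _ _ _ _ _ _ _ _ _ _ hP => eventually_criticalValues_lt hP,
    fun _ _ _ _ _ _ _ _ _ _ _ _ hP _ hW hWS => eventually_superlevel_subset hP hW hWS,
    fun _ _ _ _ _ _ _ _ _ _ hf hf' _ _ _ _ hΓs hΓ's hsub hsub' hlev hlev' hinv hinv' =>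
      nonempty_diffeomorph_sublevel_of_transport hf hf' hΓs hΓ's hsub hsub' hlev hlev' hinv hinv'⟩

end Summit.SmoothPoincare4.SmoothPoincare4.Cruxes.AgkCor6Sufficiency.LpBySphereSystemSurgery

end
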